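import Mathlib
import Summits.ValiantsHypothesis.ValiantsHypothesis.Theorems.FifoMatchingNNMonotoneHardBlocks
import Summits.ValiantsHypothesis.ValiantsHypothesis.Theorems.FifoMatchingNNMonotoneHardPadRanks
import Summits.ValiantsHypothesis.ValiantsHypothesis.Theorems.FifoMatchingNNMonotoneHardQueue
import HarnessLib

/-!
# Crux `NNMonotoneHard` (stmt-ValiantsHypothesis-11617): many boundaries for the padded word
# (piece (D) of `Cruxes/NNMonotoneHard/PROOF-PLAN.md`, instantiated)

The abstract block analysis `exists_many_boundaries` (ranks `rO, rC`, arc times `o, c` on `ℕ`) is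
instantiated with the padded word `W = U^L v D^L` (`padWord L N v`): ranks are the counts of
openers / closers before time `t`, arc times are read off `Finset.orderEmbOfFin` of the opener and
closer sets, and "respected" is the arc condition of the FIFO pairing `fifo W h`.

* `isBallot_padWord` — if `v` is balanced and its prefix sums stay in `(-m, m)` with `m ≤ L`, the
  padded word is a ballot word (so `fifo W h` is a nest-free perfect matching);
* `queue_nonempty_padWord` — in the middle the queue is nonempty (`#closers<t < #openers<t`);
* `exists_many_boundaries_padWord` — **(D) for the padded word**: if the FIFO pairing respects a
  colouring `σ` each of whose colours has `≥ Q` positions in the block region, then for some colour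
  `x` there are at least `r` middle positions `p ≥ 1` with `σ(L+p−1) ≠ x`, `σ(L+p) = x`
  (parameters as in `exists_many_boundaries`).

Honest framing: bookkeeping; VP ≠ VNP is not moved by anything here.  No definitions, no named facts.
-/

noncomputable section

-- Sub = Summit single-conjunct layout: the duplicated namespace component is mandated by the tree.
set_option linter.dupNamespace false

namespace Summit.ValiantsHypothesis.ValiantsHypothesis.Theorems.FifoMatching.NNMonotoneHard

open Finset Literature.Computability.AlgebraicComplexity

section Pad

variable {L N m : ℕ} (v : Fin N → Bool)

/-- Filters by `i < t` (`t : Fin M`) and by `i.val < t.val` agree. [folklore] -/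
theorem filter_lt_fin_eq {M : ℕ} (s : Finset (Fin M)) (t : Fin M) :
    (s.filter fun i => i < t) = s.filter fun i => i.val < t.val := by
  ext i; simp only [mem_filter, Fin.lt_def]

/-- **Counts everywhere**: if `v` is balanced with prefix sums in `(-m, m)`, `m ≤ L`, then at every
time `t ≤ L + N + L` the padded word has `#closers<t ≤ #openers<t`. [folklore] -/
theorem card_closers_lt_le_card_openers_lt_padWord
    (hbal : 2 * ((univ : Finset (Fin N)).filter fun p => v p = true).card = N)
    (hband : ∀ j, j ≤ N →
      ((univ : Finset (Fin N)).filter fun p => p.val < j ∧ v p = false).card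
        < ((univ : Finset (Fin N)).filter fun p => p.val < j ∧ v p = true).card + m)
    (hmL : m ≤ L) (t : ℕ) :
    ((closerSet (padWord L N v)).filter fun i => i.val < t).card
      ≤ ((openerSet (padWord L N v)).filter fun i => i.val < t).card := by
  rcases le_or_gt t L with ht | ht
  · obtain ⟨h1, h2⟩ := ranks_padWord_head (L := L) (N := N) v ht
    omega
  rcases le_or_gt t (L + N) with ht' | ht'
  · obtain ⟨j, rfl⟩ : ∃ j, t = L + j := ⟨t - L, by omega⟩
    obtain ⟨h1, h2⟩ := ranks_padWord_mid (L := L) (N := N) v (j := j) (by omega)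
    have := hband j (by omega)
    omega
  rcases le_or_gt t (L + N + L) with ht'' | ht''
  · obtain ⟨i, rfl⟩ : ∃ i, t = L + N + i := ⟨t - L - N, by omega⟩
    obtain ⟨h1, h2⟩ := ranks_padWord_tail (L := L) (N := N) v (i := i) (by omega)
    have := card_true_add_card_false v
    omega
  · rw [card_filter_lt_of_le _ ht''.le, card_filter_lt_of_le _ ht''.le, card_closerSet_padWord,
      card_openerSet_padWord]
    have := card_true_add_card_false v
    omega

/-- **The padded word of a balanced thick word is a ballot word.** [folklore] -/
theorem isBallot_padWord (hbal : 2 * ((univ : Finset (Fin N)).filter fun p => v p = true).card = N)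
    (hband : ∀ j, j ≤ N →
      ((univ : Finset (Fin N)).filter fun p => p.val < j ∧ v p = false).card
        < ((univ : Finset (Fin N)).filter fun p => p.val < j ∧ v p = true).card + m)
    (hmL : m ≤ L) :
    IsBallot (padWord L N v) (balanced_padWord v hbal) := by
  intro k
  by_contra hge
  rw [not_lt] at hge
  have hne : (closerSet (padWord L N v)).orderEmbOfFin (balanced_padWord v hbal) k
      ≠ (openerSet (padWord L N v)).orderEmbOfFin rfl k := by
    intro he
    have h1 := apply_closer (balanced_padWord v hbal) k
    rw [he, apply_opener k] at h1
    exact Bool.noConfusion h1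
  have hlt : (closerSet (padWord L N v)).orderEmbOfFin (balanced_padWord v hbal) k
      < (openerSet (padWord L N v)).orderEmbOfFin rfl k := lt_of_le_of_ne hge hne
  have h1 : (k : ℕ) < ((closerSet (padWord L N v)).filter fun i =>
      i < (openerSet (padWord L N v)).orderEmbOfFin rfl k).card :=
    (orderEmbOfFin_lt_iff (balanced_padWord v hbal) k _).1 hlt
  have h2 : ((openerSet (padWord L N v)).filter fun i =>
      i < (openerSet (padWord L N v)).orderEmbOfFin rfl k).card = k :=
    card_filter_lt_orderEmbOfFin rfl k
  have h3 := card_closers_lt_le_card_openers_lt_padWord v hbal hband hmL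
    ((openerSet (padWord L N v)).orderEmbOfFin rfl k).val
  rw [filter_lt_fin_eq] at h1 h2
  omega

/-- **The queue is nonempty in the middle**: at a middle time `t = L + j`, `1 ≤ j ≤ N`... indeed at
every `t` with `L ≤ t ≤ L + N`, `#closers<t < #openers<t` (the queue holds at least `L − m + 1 ≥ 1`
arcs). [folklore] -/
theorem queue_nonempty_padWord
    (hband : ∀ j, j ≤ N →
      ((univ : Finset (Fin N)).filter fun p => p.val < j ∧ v p = false).card
        < ((univ : Finset (Fin N)).filter fun p => p.val < j ∧ v p = true).card + m)
    (hmL : m ≤ L) {t : ℕ} (ht : L ≤ t) (ht' : t ≤ L + N) :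
    ((closerSet (padWord L N v)).filter fun i => i.val < t).card
      < ((openerSet (padWord L N v)).filter fun i => i.val < t).card := by
  obtain ⟨j, rfl⟩ : ∃ j, t = L + j := ⟨t - L, by omega⟩
  obtain ⟨h1, h2⟩ := ranks_padWord_mid (L := L) (N := N) v (j := j) (by omega)
  have := hband j (by omega)
  omega

/-- The `k`-th element of `s` below time `t` is the `k`-th element of `s ∩ [0, t)`. [folklore] -/
theorem orderEmbOfFin_eq_of_filter {M : ℕ} (s : Finset (Fin M)) {n' : ℕ} (h : s.card = n') (t : Fin M)
    (k : Fin n') (hk : (k : ℕ) < (s.filter fun i => i < t).card) :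
    s.orderEmbOfFin h k = (s.filter fun i => i < t).orderEmbOfFin rfl ⟨k, hk⟩ := by
  set c := (s.filter fun i => i < t).card with hc
  have hcn : c ≤ n' := h ▸ card_filter_le _ _
  let f : Fin c → Fin M := fun j => s.orderEmbOfFin h ⟨j, lt_of_lt_of_le j.isLt hcn⟩
  have hfs : ∀ j, f j ∈ s.filter fun i => i < t := by
    intro j
    rw [mem_filter]
    refine ⟨orderEmbOfFin_mem _ _ _, ?_⟩
    rw [orderEmbOfFin_lt_iff]
    exact j.isLt
  have hmono : StrictMono f := by
    intro a b hab
    exact (s.orderEmbOfFin h).strictMono (Fin.mk_lt_mk.2 hab)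
  have := orderEmbOfFin_unique rfl hfs hmono
  have hk' := congrFun this ⟨k, hk⟩
  simpa [f] using hk'

/-- **(D) for the padded word.**  Let `v` be balanced with prefix sums in `(-m, m)`, `1 ≤ m ≤ L`,
let the FIFO pairing of `W = U^L v D^L` respect `σ`, cut `[L, L + JK)` into `J` blocks of length
`K ≥ 2L + 4m + 2` with `JK + 1 ≤ N`, and suppose each colour of `σ` has `≥ Q` positions in
`[L, L + JK)`, `4r ≤ J`, `2Kr ≤ Q`, `2mr + 3m ≤ L`.  Then for some colour `x` at least `r`
middle positions `p ∈ [1, N)` are boundaries into `x`: `σ(L + p − 1) ≠ x = σ(L + p)`. [folklore] -/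
theorem exists_many_boundaries_padWord {K J r Q : ℕ}
    (hbal : 2 * ((univ : Finset (Fin N)).filter fun p => v p = true).card = N)
    (hband : ∀ j, j ≤ N →
      ((univ : Finset (Fin N)).filter fun p => p.val < j ∧ v p = false).card
        < ((univ : Finset (Fin N)).filter fun p => p.val < j ∧ v p = true).card + m ∧
      ((univ : Finset (Fin N)).filter fun p => p.val < j ∧ v p = true).card
        < ((univ : Finset (Fin N)).filter fun p => p.val < j ∧ v p = false).card + m)
    (hmL : m ≤ L) (hm : 1 ≤ m) (hK : 2 * L + 4 * m + 2 ≤ K) (hJ : J * K + 1 ≤ N)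
    (σ : Fin (L + N + L) → Bool)
    (hresp : ∀ k : Fin (openerSet (padWord L N v)).card,
      σ ((openerSet (padWord L N v)).orderEmbOfFin rfl k)
        = σ ((closerSet (padWord L N v)).orderEmbOfFin (balanced_padWord v hbal) k))
    (hcol : ∀ b : Bool, Q ≤ ((range (L + J * K)).filter fun t =>
      L ≤ t ∧ (if ht : t < L + N + L then σ ⟨t, ht⟩ else false) = b).card)
    (hr1 : 4 * r ≤ J) (hr2 : 2 * K * r ≤ Q) (hr3 : 2 * m * r + 3 * m ≤ L) :
    ∃ x : Bool, r ≤ ((univ : Finset (Fin N)).filter fun p => ∃ hp : 1 ≤ p.val,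
      σ ⟨L + p.val - 1, by omega⟩ ≠ x ∧ σ ⟨L + p.val, by omega⟩ = x).card := by
  classical
  have h := balanced_padWord (L := L) v hbal
  -- the abstract data (`PW = padWord L N v`, `M = L + N + L`, `n' = #openers`)
  set Wn : ℕ → Bool := fun t => if ht : t < L + N + L then padWord L N v ⟨t, ht⟩ else true with hWn
  set σn : ℕ → Bool := fun t => if ht : t < L + N + L then σ ⟨t, ht⟩ else false with hσn
  set rO : ℕ → ℕ := fun t =>
    ((openerSet (padWord L N v)).filter fun i => i.val < t).card + (t - (L + N + L)) with hrO
  set rC : ℕ → ℕ := fun t => ((closerSet (padWord L N v)).filter fun i => i.val < t).card with hrC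
  set on : ℕ → ℕ := fun k => if hk : k < (openerSet (padWord L N v)).card then
    (((openerSet (padWord L N v)).orderEmbOfFin rfl ⟨k, hk⟩ : Fin (L + N + L)) : ℕ) else 0 with hon
  set cn : ℕ → ℕ := fun k => if hk : k < (openerSet (padWord L N v)).card then
    (((closerSet (padWord L N v)).orderEmbOfFin h ⟨k, hk⟩ : Fin (L + N + L)) : ℕ) else 0 with hcn
  -- the axioms
  have hO0 : rO 0 = 0 := by simp [hrO]
  have hC0 : rC 0 = 0 := by simp [hrC]
  have hOs : ∀ t, rO (t + 1) = rO t + (if Wn t = true then 1 else 0) := by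
    intro t
    simp only [hrO, hWn]
    rw [card_filter_lt_succ_nat]
    by_cases ht : t < L + N + L
    · rw [dif_pos ht, dif_pos ht]
      simp only [mem_openerSet]
      have : t + 1 - (L + N + L) = 0 := by omega
      have : t - (L + N + L) = 0 := by omega
      split_ifs <;> omega
    · rw [dif_neg ht, dif_neg ht]
      simp only [if_true]
      omega
  have hCs : ∀ t, rC (t + 1) = rC t + (if Wn t = true then 0 else 1) := by
    intro t
    simp only [hrC, hWn]
    rw [card_filter_lt_succ_nat]
    by_cases ht : t < L + N + L
    · rw [dif_pos ht, dif_pos ht]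
      simp only [mem_closerSet]
      cases padWord L N v ⟨t, ht⟩ <;> simp
    · rw [dif_neg ht, dif_neg ht]
      simp
  have ho : ∀ k t, k < (openerSet (padWord L N v)).card → (on k < t ↔ k < rO t) := by
    intro k t hk
    simp only [hon, hrO, dif_pos hk]
    by_cases ht : t < L + N + L
    · have e1 := orderEmbOfFin_lt_iff (rfl : (openerSet (padWord L N v)).card = _) ⟨k, hk⟩ ⟨t, ht⟩
      rw [filter_lt_fin_eq, Fin.lt_def] at e1
      rw [e1, show t - (L + N + L) = 0 by omega, add_zero]
    · rw [not_lt] at ht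
      rw [card_filter_lt_of_le _ ht]
      constructor
      · intro; omega
      · intro; exact lt_of_lt_of_le (Fin.isLt _) ht
  have hc : ∀ k t, k < (openerSet (padWord L N v)).card → (cn k < t ↔ k < rC t) := by
    intro k t hk
    simp only [hcn, hrC, dif_pos hk]
    by_cases ht : t < L + N + L
    · have e1 := orderEmbOfFin_lt_iff h ⟨k, hk⟩ ⟨t, ht⟩
      rw [filter_lt_fin_eq, Fin.lt_def] at e1
      rw [e1]
    · rw [not_lt] at ht
      rw [card_filter_lt_of_le _ ht, h]
      constructor
      · intro; exact hk
      · intro; exact lt_of_lt_of_le (Fin.isLt _) ht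
  have hrespn : ∀ k, k < (openerSet (padWord L N v)).card → σn (on k) = σn (cn k) := by
    intro k hk
    simp only [hσn, hon, hcn, dif_pos hk, Fin.isLt, dif_pos, Fin.eta]
    exact hresp ⟨k, hk⟩
  -- band on `[L, L + N - 1]`
  have hbandn : ∀ t, L ≤ t → t ≤ L + N - 1 →
      L ≤ rO t - rC t + m ∧ rO t ≤ rC t + L + m ∧ rC t ≤ rO t := by
    intro t ht1 ht2
    obtain ⟨j, rfl⟩ : ∃ j, t = L + j := ⟨t - L, by omega⟩
    obtain ⟨h1, h2⟩ := ranks_padWord_mid (L := L) (N := N) v (j := j) (by omega)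
    have hb := hband j (by omega)
    simp only [hrO, hrC]
    rw [h1, h2, show L + j - (L + N + L) = 0 by omega]
    omega
  have hn : rO (L + N - 1) ≤ (openerSet (padWord L N v)).card := by
    simp only [hrO]
    rw [show L + N - 1 - (L + N + L) = 0 by omega, add_zero]
    exact card_filter_le _ _
  -- colour counts
  have hbal' : ∀ b : Bool, Q ≤ ((range (L + J * K)).filter fun t => L ≤ t ∧ σn t = b).card := by
    intro b
    simp only [hσn]
    exact hcol b
  obtain ⟨x, hx⟩ := exists_many_boundaries hO0 hC0 hOs hCs ho hc hrespn (A := L) (E := L + N - 1)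
    hK (by omega) hn hbandn hbal' hr1 hr2 hr3 hm
  refine ⟨x, hx.trans ?_⟩
  -- transport the boundary count to middle positions `p = u - L`
  have hsub : ((range (L + N - 1 + 1)).filter fun u => L < u ∧ σn (u - 1) ≠ x ∧ σn u = x) ⊆
      (((univ : Finset (Fin N)).filter fun p => ∃ hp : 1 ≤ p.val,
        σ ⟨L + p.val - 1, by omega⟩ ≠ x ∧ σ ⟨L + p.val, by omega⟩ = x).image
        fun p => L + p.val) := by
    intro u hu
    rw [mem_filter, mem_range] at hu
    obtain ⟨huN, hLu, h1, h2⟩ := hu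
    rw [mem_image]
    refine ⟨⟨u - L, by omega⟩, ?_, by simp only; omega⟩
    rw [mem_filter]
    refine ⟨mem_univ _, by simp only; omega, ?_, ?_⟩
    · simp only [hσn, dif_pos (show u - 1 < L + N + L by omega)] at h1
      convert h1 using 3
      simp only; omega
    · simp only [hσn, dif_pos (show u < L + N + L by omega)] at h2
      convert h2 using 3
      simp only; omega
  exact (card_le_card hsub).trans card_image_le

end Pad

end Summit.ValiantsHypothesis.ValiantsHypothesis.Theorems.FifoMatching.NNMonotoneHard
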